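/-
Copyright (c) 2026 the pub-hodgecm-mathlib formalisation cell (harness21).  Prover seat hodgecm-mathlib-R90-C14-p04 (g0) (free R90-TF hand routed to L1 by
CHAIR VALVE WORD W4), Track B «K2-LIT» ∕ hLiu418 #184♮, Road I v3, unit U5 «THE CLOSE»: FACE-D₀ row `h2₂`, census (B1c′) brick (B1c′-3).  THEOREMS ONLY.  2026-09-05.
-/
import Literature.NumberTheory.Weil1964.AdelicOperatorsLF     -- ★ `chirpLM_eq_adelicTensorEnd`, `finMulLM`, `coe_finMulLM`; brings ★ `archSdCharCLM(_apply)`, `finSdChar`, `adelicTensorEnd_apply_tmul`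
import HarnessLib

/-!
# K2_Liu road (hLiu418 = stmt-HodgeConjecture-24832), FACE-D₀ row `h2₂`, census (B1c′) brick (B1c′-3): A FINITE CHIRP ACTS IN THE FINITE SLOT

Cell `pub/hodgecm-mathlib` (D-0151), Track B, build stream 29; helper lane `--supports stmt-HodgeConjecture-24832 --as helper`, count-neutral.  Census memo
`R90/R90-C14-p04/g0/CENSUS-B1c-core.R90-C14-p04-g0.md` 1e24b338b846d705: the one letter `hκ` of ★ `K2LiuFirstTermLineLiftRankRowModelConj` (p863332) says that in the
κ-model a FINITE Siegel unipotent acts on a pure tensor `Φ_∞ ⊗ φ` by a chirp MULTIPLIER in the finite slot; after (B1c′-1)(B1c′-2) ((K-f) at the big line datum: the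
κ-conjugate of a unipotent IS Weil's `t(S_u) = chirpLM S_u`, ★ `coe_toOp_adelicSiegelLift`) the last step is THIS file: for an adelic symmetric parameter `S` with
archimedean part `0` — which is the case for a unipotent supported at the finite places — Weil's `t(S)` moves a pure tensor INSIDE THE FINITE SLOT, by the locally
constant multiplier `ψ_f(q_{S_f})` (★ `finSdChar`):
* `archSdCharCLM_zero_apply` — `t(0_∞) = 1` on `𝓢((F ⊗ ℝ)ⁿ)` (`𝐞(-q_0) = 1`);
* **`chirpLM_tmul_of_archPart_eq_zero`** — `t(S)(Φ_∞ ⊗ Φ_f) = Φ_∞ ⊗ (ψ_f(q_{S_f}) · Φ_f)` whenever `S_∞ = 0` (★ `chirpLM_eq_adelicTensorEnd` + ★ `adelicTensorEnd_apply_tmul`).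
So the `ρf z := finMulLM (finSdChar (S_{ι z})_f) _` of the census is a multiplier representation on `𝒮(𝔸_f^{n″}) = FinSB`, exactly the shape ★ U2a's σ-twin reads.
[Weil1964, Chap. I n° 13 p. 160 (`t(f)`), n° 34 p. 184; Chap. III n° 37–38 pp. 188–190 (`𝐫_𝐀 = ⊗_v 𝐫_v`)].

No definition, no instance, no notation, no named-fact hypothesis, no `sorry`; axioms ⊆ {propext, Classical.choice, Quot.sound}.  HONEST LABEL: HC_CM is proved only modulo
the 7 printed citations (2 remaining named inputs: hLiu418 = stmt-HodgeConjecture-24832, h413 = stmt-HodgeConjecture-24833) until rung 0 closes; this file moves no counter.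

References: [Weil1964] A. Weil, *Sur certains groupes d'opérateurs unitaires*, Acta Math. 111 (1964), Chap. I n° 13 p. 160, n° 34 p. 184, Chap. III n° 37–38 pp. 188–190.
-/

set_option autoImplicit false
set_option linter.dupNamespace false

noncomputable section

open NumberField NumberField.mixedEmbedding IsDedekindDomain
open scoped Matrix SchwartzMap TensorProduct Classical

namespace Summit.HodgeConjecture.HodgeConjecture.Cruxes.HLiu418.K2LiuFinChirpTensorSlot

open Literature.NumberTheory.Automorphic Literature.NumberTheory.Weil1964

variable (F : Type) [Field F] [NumberField F] {n : ℕ}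

/-- **`t(0_∞) = 1`**: the archimedean second-degree character of the zero matrix is `1`, so Weil's archimedean chirp `t(0)` is the identity of `𝓢((F ⊗ ℝ)ⁿ)`.
[cite: Weil1964, Chap. I n° 34 p. 184] -/
theorem archSdCharCLM_zero_apply (Φ : 𝓢((Fin n → mixedSpace F), ℂ)) :
    archSdCharCLM F (0 : Matrix (Fin n) (Fin n) (mixedSpace F)) Φ = Φ := by
  ext a
  rw [archSdCharCLM_apply, archSdChar_apply, Matrix.vecMul_zero, map_zero, neg_zero, AddChar.map_zero_eq_one, Circle.coe_one, one_mul]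

/-- **A FINITE CHIRP ACTS IN THE FINITE SLOT**: if the archimedean part of the adelic symmetric parameter `S` vanishes, Weil's `t(S)` (★ `chirpLM`) maps the pure tensor
`Φ_∞ ⊗ Φ_f ∈ 𝒮(𝔸_Fⁿ)` to `Φ_∞ ⊗ (ψ_f(q_{S_f}) · Φ_f)` — multiplication by the locally constant finite second-degree character in the FINITE factor only
(★ `chirpLM_eq_adelicTensorEnd`: `t(S) = t(S_∞) ⊗ t(S_f)`, and `t(0_∞) = 1`).  This is the shape of the multiplier representation `ρf` that ★
`K2LiuFirstTermLineLiftRankRowModelConj`'s letter `hκ` asks for. [cite: Weil1964, Chap. I n° 13 p. 160; n° 34 p. 184; Chap. III n° 37–38 pp. 188–190] -/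
theorem chirpLM_tmul_of_archPart_eq_zero (S : Matrix (Fin n) (Fin n) (AdeleRing (𝓞 F) F)) (hS : S.map (archHom F) = 0)
    (Φinf : 𝓢((Fin n → mixedSpace F), ℂ)) (Φfin : FinSB F (Fin n)) :
    chirpLM F S (piSchwartzBruhatEquiv F (Fin n) (Φinf ⊗ₜ[ℂ] Φfin)) =
      piSchwartzBruhatEquiv F (Fin n) (Φinf ⊗ₜ[ℂ]
        finMulLM (finSdChar (S.map (RingHom.snd (InfiniteAdeleRing F) (FiniteAdeleRing (𝓞 F) F)))) (isLocallyConstant_finSdChar _) Φfin) := by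
  rw [chirpLM_eq_adelicTensorEnd, adelicTensorEnd_apply_tmul, hS]
  congr 2
  exact archSdCharCLM_zero_apply F Φinf

end Summit.HodgeConjecture.HodgeConjecture.Cruxes.HLiu418.K2LiuFinChirpTensorSlot

end
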